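import Summits.BirchSwinnertonDyer.BirchSwinnertonDyer.Theorems.PrintCFramBottomClassIndexLawFiveLeLevelDictionaryLine
import Summits.BirchSwinnertonDyer.BirchSwinnertonDyer.Theorems.ByReductionTypeAtTwoMultTransportTwistedDescentResOntoInvariants
import Summits.BirchSwinnertonDyer.Rank1Residual.X11b.LocalTrivialityBridge
import Literature.NumberTheory.GaloisRepresentations.FiniteGroupAveraging
import HarnessLib

/-!
# Route `PrintCFram`, crux C2 `BottomClassIndexLawFiveLe` (stmt-BirchSwinnertonDyer-20372), line
# `eisenstein-resource-bdp-line` (LEAD g10, report §2(d) / §4): **THE LEVEL DICTIONARY, DESCENT STEP** — an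
# equivariant unramified homomorphism on `N = ker(Γ_K → Aut A)` is the restriction of an everywhere-unramified
# class of `H¹(K, A)` (inflation–restriction SURJECTIVITY at index prime to `p`)
# (cell `bsd-print-cfram`, width seat `bsd-line-cfram-p1-w4` g8; helper `--supports` 20372; 0 defs, 0 facts,
# 0 sorry)

HONEST FRAMING. Nothing about BSD is proved here, and nothing of any stub. This is the LINK between w6 g2's
(β) class-group half (`HerbrandOddClassGroup.exists_absGaloisHom_ne_one_of_…`: a non-zero unramified equivariant
homomorphism on the splitting group) and the (β) Galois half `levelPos_or_sha_of_unramified_sub_class`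
(p669667); the CONVERSE of p668199's `hom_of_unramified_class`. Pure group cohomology on a discrete
`Γ_K`-module `A` of PRIME order `p` with continuous orbit maps; `N = ker(Γ_K → Aut A)` has index `∣ p − 1`.

* §1 `subsingleton_continuousCohomology_two_quotientInvariants(_of_coprime)` — `H²(Γ_K ⧸ N', A^{N'}) = 0` for an
  open normal `N'` of index prime to `p` (in particular `N`): the identity of `A` is the trace of `u·id` with
  `u·[Γ_K : N'] ≡ 1 (mod p)` (tree `FiniteGroupAveraging.subsingleton_continuousCohomology_two_of_avg_eq`).
* §2 `exists_principal_on_of_vanish_on_inf_ker` — a continuous 1-cocycle of `Γ_K` vanishing on `I ∩ N`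
  is PRINCIPAL on the subgroup `I`: the image of `I` in `Aut A ≅ 𝔽_pˣ` is cyclic, generated by some
  `θ(i₀) = c`; if `c = 1` the cocycle vanishes on `I`, else `w − ∂((c−1)⁻¹ w(i₀))` vanishes on `i₀` and
  on `I ∩ N`, hence on `I = ⋃ i₀^k (I ∩ N)`.
* §2 `apply_eq_zero_of_mem_ker_of_vanish_on_inf` — vanishing on `I ∩ N'` ⟹ vanishing on `I ∩ N` when
  `[Γ_K : N']` is prime to `p` (`g^{[Γ_K:N']} ∈ N'`).
* §3 **`exists_unramified_class_of_hom_of_le_ker`** (any open normal `N' ≤ N` of index prime to `p`, e.g.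
  `N' = res Γ_L`, `p ∤ [L:K]`) and **`exists_unramified_class_of_hom`** (`N' = N`) — `G₀ : Γ_K → A` continuous
  and additive on `N'`, `Γ_K`-equivariant (`G₀(g n g⁻¹) = g • G₀ n`), killing `N' ∩ I_𝔓` for every prime `𝔓` of
  `\bar ℤ_K`, and non-zero on `N'` ⟹ there is a continuous 1-cocycle `w : Γ_K → A` with NON-ZERO class which
  is principal on every `I_𝔓` (and `w|_{N'} = G₀|_{N'}`). Proof: the class of `G₀|_N` in `H¹(N, A)` is `Γ_K`-invariant
  (equivariance), hence restricted from `Γ_K` by the element form of Hochschild–Serre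
  (`MultTransportTwistedDescent.exists_resSubgroup_eq_of_forall_conjMap_eq_of_subsingleton_two`) and §1;
  coboundaries vanish on `N`, so the lift agrees with `G₀` on `N`; §2 gives the inertia groups.

THEOREMS ONLY; no definition, no named fact, no `sorry`. BSD is not proved by any of this. References:
[SerreGaloisCohomology1997] I.§2.6 (b); [NeukirchSchmidtWingberg2008] (1.6.7); [SerreLocalFields1979] VIII §1.
-/

set_option autoImplicit false
-- `…BirchSwinnertonDyer.BirchSwinnertonDyer.Theorems…` is the problem's mandated namespace (D-0017).
set_option linter.dupNamespace false

noncomputable section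

open scoped Classical Pointwise

namespace Summit.BirchSwinnertonDyer.BirchSwinnertonDyer.Theorems.PrintCFram.LevelDictionary

open NumberField IsDedekindDomain Field
open Literature.NumberTheory.EllipticCurves Literature.NumberTheory.GaloisRepresentations
open Summit.BirchSwinnertonDyer.Rank1Residual
open Summit.BirchSwinnertonDyer.Rank1Residual.X11b

variable {K : Type} [Field K] [NumberField K] {p : ℕ} [hp : Fact p.Prime]
variable {A : Type} [AddCommGroup A] [DistribMulAction (absoluteGaloisGroup K) A] [TopologicalSpace A]
  [DiscreteTopology A]

omit [NumberField K] in
/-- Open stabilisers from continuous orbit maps. [folklore] -/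
theorem isOpen_stabilizer_of_continuous_smul
    (hcont : ∀ a : A, Continuous fun g : absoluteGaloisGroup K ↦ g • a) (m : A) :
    IsOpen {σ : absoluteGaloisGroup K | σ • m = m} :=
  (isOpen_discrete ({m} : Set A)).preimage (hcont m)

/-! ## §1 `H²(Γ_K ⧸ N, A^N) = 0` -/

omit [NumberField K] [TopologicalSpace A] [DiscreteTopology A] in
/-- **`p ∤ [Γ_K : N]` numerically**: the index of `N = ker(Γ_K → Aut A)` (`#A = p`) is positive, prime to `p`,
and some `u` has `[Γ_K : N] · u ≡ 1 (mod p)`. [folklore] -/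
theorem exists_index_mul_mod_eq_one (hcard : Nat.card A = p) :
    ∃ u : ℕ, (MulAction.toPermHom (absoluteGaloisGroup K) A).ker.index * u % p = 1 ∧
      (MulAction.toPermHom (absoluteGaloisGroup K) A).ker.index ≠ 0 := by
  have hdvd := HerbrandLineRestriction.index_ker_toPermHom_dvd
    (G := absoluteGaloisGroup K) (A := A) hcard
  have hp1 : 0 < p - 1 := by have := hp.out.two_le; omega
  have hidx0 : (MulAction.toPermHom (absoluteGaloisGroup K) A).ker.index ≠ 0 := fun h0 ↦ by
    rw [h0] at hdvd
    exact absurd (Nat.eq_zero_of_zero_dvd hdvd) hp1.ne'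
  have hlt : (MulAction.toPermHom (absoluteGaloisGroup K) A).ker.index < p :=
    lt_of_le_of_lt (Nat.le_of_dvd hp1 hdvd) (Nat.sub_lt hp.out.pos Nat.one_pos)
  have hcop : Nat.Coprime (MulAction.toPermHom (absoluteGaloisGroup K) A).ker.index p :=
    (Nat.coprime_comm.mp ((Nat.Prime.coprime_iff_not_dvd hp.out).2
      fun h ↦ absurd (Nat.le_of_dvd (Nat.pos_of_ne_zero hidx0) h) (not_le.mpr hlt)))
  obtain ⟨u, -, hu⟩ := Nat.exists_mul_mod_eq_one_of_coprime hcop hp.out.one_lt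
  exact ⟨u, hu, hidx0⟩

omit [NumberField K] [TopologicalSpace A] [DiscreteTopology A] hp in
/-- `(m · u) • a = a` when `m · u ≡ 1 (mod p)` and `p • a = 0`. [folklore] -/
theorem mul_nsmul_eq_self_of_mod_eq_one {B : Type*} [AddCommGroup B] {m u : ℕ} (hmu : m * u % p = 1)
    {a : B} (hpa : p • a = 0) : (m * u) • a = a := by
  conv_lhs => rw [← Nat.div_add_mod (m * u) p, hmu]
  rw [add_nsmul, one_nsmul, mul_comm p]
  have h0 : (m * u / p * p) • a = 0 := by
    first
    | rw [mul_nsmul, hpa, smul_zero]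
    | rw [mul_nsmul', hpa, smul_zero]
  rw [h0, zero_add]

omit [NumberField K] hp in
/-- **`H²(Γ_K ⧸ N', A^{N'}) = 0` at index prime to `p`.** For a normal OPEN subgroup `N' ⊴ Γ_K` of finite index
with `[Γ_K : N'] · u ≡ 1 (mod p)` and a `p`-torsion discrete `Γ_K`-module `A` (continuous orbit maps), the second
continuous cohomology of the finite discrete group `Γ_K ⧸ N'` on `A^{N'}` vanishes: the identity of `A^{N'}` is
the trace `Σ_{q ∈ Γ_K/N'} q · (u · q⁻¹(−))`, so `H² = 0` by averaging
(`FiniteGroupAveraging.subsingleton_continuousCohomology_two_of_avg_eq`). [cite: SerreLocalFields1979, VIII §1]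
[cite: SerreGaloisCohomology1997, I §2.6 (b)] -/
theorem subsingleton_continuousCohomology_two_quotientInvariants_of_coprime
    (hcont : ∀ a : A, Continuous fun g : absoluteGaloisGroup K ↦ g • a) (hpA : ∀ a : A, p • a = 0)
    (N' : Subgroup (absoluteGaloisGroup K)) [N'.Normal] (hopen : IsOpen (N' : Set (absoluteGaloisGroup K)))
    (hidx0 : N'.index ≠ 0) {u : ℕ} (hu : N'.index * u % p = 1) :
    Subsingleton (continuousCohomology 2
      (ContinuousRep.quotientInvariants N'
        (LocBridge.ofSMul A (isOpen_stabilizer_of_continuous_smul hcont))).toTopRep) := by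
  haveI : N'.FiniteIndex := ⟨hidx0⟩
  haveI : Fintype (absoluteGaloisGroup K ⧸ N') := Subgroup.fintypeQuotientOfFiniteIndex
  haveI : DiscreteTopology (absoluteGaloisGroup K ⧸ N') := QuotientGroup.discreteTopology hopen
  set ρ := LocBridge.ofSMul A (isOpen_stabilizer_of_continuous_smul hcont) with hρ
  refine subsingleton_continuousCohomology_two_of_avg_eq (ContinuousRep.quotientInvariants N' ρ)
    (u • AddMonoidHom.id _) fun a ↦ ?_
  -- the trace of `u · id` is the identity on `A^{N'}`
  have hpa : ∀ b : ρ.invariantsOf N', p • b = 0 := fun b ↦ Subtype.ext (by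
    rw [AddSubmonoidClass.coe_nsmul, ZeroMemClass.coe_zero]
    exact hpA (b : A))
  have hterm : ∀ q : absoluteGaloisGroup K ⧸ N',
      ContinuousRep.quotientInvariants N' ρ q
        ((u • AddMonoidHom.id _) (ContinuousRep.quotientInvariants N' ρ q⁻¹ a)) = u • a := by
    intro q
    obtain ⟨σ, rfl⟩ := QuotientGroup.mk_surjective q
    rw [AddMonoidHom.nsmul_apply, AddMonoidHom.id_apply, map_nsmul]
    congr 1
    apply Subtype.ext
    change σ • (σ⁻¹ • (a : A)) = (a : A)
    rw [smul_inv_smul]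
  unfold avgFun
  simp_rw [hterm]
  rw [Finset.sum_const, Finset.card_univ, ← mul_nsmul', ← Nat.card_eq_fintype_card, ← Subgroup.index_eq_card]
  exact mul_nsmul_eq_self_of_mod_eq_one hu (hpa a)

omit [NumberField K] in
/-- **`H²(Γ_K ⧸ N, A^N) = 0`** for `N = ker(Γ_K → Aut A)`, `#A = p`. [cite: SerreGaloisCohomology1997, I §2.6 (b)] -/
theorem subsingleton_continuousCohomology_two_quotientInvariants (hcard : Nat.card A = p)
    (hcont : ∀ a : A, Continuous fun g : absoluteGaloisGroup K ↦ g • a) :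
    Subsingleton (continuousCohomology 2
      (ContinuousRep.quotientInvariants (MulAction.toPermHom (absoluteGaloisGroup K) A).ker
        (LocBridge.ofSMul A (isOpen_stabilizer_of_continuous_smul hcont))).toTopRep) := by
  obtain ⟨u, hu, hidx0⟩ := exists_index_mul_mod_eq_one (K := K) (A := A) hcard
  haveI : Finite A := Nat.finite_of_card_ne_zero (by rw [hcard]; exact hp.out.ne_zero)
  exact subsingleton_continuousCohomology_two_quotientInvariants_of_coprime hcont
    (HerbrandLineRestriction.prime_nsmul_eq_zero_of_card_prime hcard) _
    (HerbrandLineRestriction.isOpen_ker_toPermHom hcont) hidx0 hu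

/-! ## §2 Vanishing on `I ∩ N` ⟹ principal on `I` -/

omit [NumberField K] in
/-- The twisted function `g ↦ w g − (g • b − b)` (a cocycle minus a coboundary) satisfies the crossed
homomorphism identity. [cite: SerreGaloisCohomology1997, I.§5.1] -/
theorem sub_coboundary_mul (w : contOneCocycles (discreteTopRep (absoluteGaloisGroup K) A)) (b : A)
    (g h : absoluteGaloisGroup K) :
    w.1 (g * h) - ((g * h) • b - b) = (w.1 g - (g • b - b)) + g • (w.1 h - (h • b - b)) := by
  rw [cocycle_mul' w g h, mul_smul, smul_sub, smul_sub]
  abel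

omit [NumberField K] in
/-- **A continuous crossed homomorphism of `Γ_K` into a module of prime order `p` that vanishes on `I ∩ N`,
`N = ker(Γ_K → Aut A)`, is PRINCIPAL on the subgroup `I`.** The image of `I` in `Aut A` is a finite subgroup of
`𝔽_pˣ` (T2 `exists_character_of_card_prime`), hence cyclic, generated by the image `c` of some `i₀ ∈ I`; if
`c = 1` then `I ≤ N` and `w` vanishes on `I`; otherwise `b = (c − 1)⁻¹ w(i₀)` has `w(i₀) = i₀ b − b`, and the
crossed homomorphism `w − ∂b` vanishes at `i₀` and on `I ∩ N`, hence on every `i₀^k n`, i.e. on `I`.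
[cite: SerreGaloisCohomology1997, I.§5.1] -/
theorem exists_principal_on_of_vanish_on_inf_ker (hcard : Nat.card A = p) (I : Subgroup (absoluteGaloisGroup K))
    (w : contOneCocycles (discreteTopRep (absoluteGaloisGroup K) A))
    (hw : ∀ g ∈ I, g ∈ (MulAction.toPermHom (absoluteGaloisGroup K) A).ker → w.1 g = 0) :
    ∃ b : A, ∀ g ∈ I, w.1 g = g • b - b := by
  obtain ⟨θ, hθ, hker⟩ := HerbrandLineRestriction.exists_character_of_card_prime
    (G := absoluteGaloisGroup K) (A := A) hcard
  letI : Module (ZMod p) A :=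
    AddCommGroup.zmodModule (HerbrandLineRestriction.prime_nsmul_eq_zero_of_card_prime hcard)
  have hmemN : ∀ g : absoluteGaloisGroup K, θ g = 1 → g ∈ (MulAction.toPermHom (absoluteGaloisGroup K) A).ker :=
    fun g hg ↦ (HerbrandLineRestriction.mem_ker_toPermHom_iff g).2 ((hker g).1 hg)
  -- the scalar of `g` as an element of `ZMod p`
  have hsmul : ∀ (g : absoluteGaloisGroup K) (x : A), g • x = (θ g : ZMod p) • x := fun g x ↦ by
    rw [hθ g x, natCast_zsmul, ← Nat.cast_smul_eq_nsmul (ZMod p), ZMod.natCast_zmod_val]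
  -- the image of `I` in `𝔽_pˣ` is cyclic
  set S : Subgroup (ZMod p)ˣ := (θ.comp I.subtype).range with hS
  haveI : Finite S := inferInstance
  obtain ⟨γ, hγ⟩ := IsCyclic.exists_zpow_surjective (G := S)
  obtain ⟨i₀, hi₀⟩ := (MonoidHom.mem_range).1 γ.2
  -- every `g ∈ I` is `i₀^k · n` with `n ∈ I ∩ N`
  have hdec : ∀ g ∈ I, ∃ (k : ℤ) (n : absoluteGaloisGroup K), n ∈ I ∧
      n ∈ (MulAction.toPermHom (absoluteGaloisGroup K) A).ker ∧ g = (i₀ : absoluteGaloisGroup K) ^ k * n := by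
    intro g hg
    obtain ⟨k, hk⟩ := hγ ⟨θ g, (MonoidHom.mem_range).2 ⟨⟨g, hg⟩, rfl⟩⟩
    have hk' : θ ((i₀ : absoluteGaloisGroup K) ^ k) = θ g := by
      have := congrArg (fun s : S ↦ ((s : (ZMod p)ˣ))) hk
      simp only [SubgroupClass.coe_zpow] at this
      rw [map_zpow, ← this, ← hi₀]
      rfl
    refine ⟨k, ((i₀ : absoluteGaloisGroup K) ^ k)⁻¹ * g,
      I.mul_mem (I.inv_mem (I.zpow_mem i₀.2 k)) hg, hmemN _ ?_, by group⟩
    rw [map_mul, map_inv, hk', inv_mul_cancel]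
  by_cases hc : (θ i₀ : ZMod p) = 1
  · -- `I ≤ N`: `w` vanishes on `I`
    refine ⟨0, fun g hg ↦ ?_⟩
    rw [smul_zero, sub_zero]
    apply hw g hg
    obtain ⟨k, n, -, hnN, rfl⟩ := hdec g hg
    refine Subgroup.mul_mem _ (Subgroup.zpow_mem _ (hmemN _ (Units.ext ?_)) k) hnN
    rw [Units.val_one]
    exact hc
  · -- `c ≠ 1`: subtract the coboundary of `b = (c−1)⁻¹ w(i₀)`
    set c : ZMod p := (θ (i₀ : absoluteGaloisGroup K) : ZMod p) with hcdef
    have hc1 : c - 1 ≠ 0 := sub_ne_zero.mpr hc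
    set b : A := (c - 1)⁻¹ • w.1 i₀ with hb
    have hi₀b : w.1 i₀ - ((i₀ : absoluteGaloisGroup K) • b - b) = 0 := by
      rw [hsmul, hb, smul_smul, ← hcdef]
      have : c • (c - 1)⁻¹ • w.1 i₀ - (c - 1)⁻¹ • w.1 i₀ = (c - 1) • (c - 1)⁻¹ • w.1 i₀ := by
        rw [sub_smul, one_smul]
      rw [← smul_smul, this, smul_smul, mul_inv_cancel₀ hc1, one_smul, sub_self]
    -- `f = w − ∂b` vanishes on `I ∩ N` and at `i₀`, hence on `i₀^k` and on `I`
    set f : absoluteGaloisGroup K → A := fun g ↦ w.1 g - (g • b - b) with hf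
    have hfmul : ∀ g h, f (g * h) = f g + g • f h := fun g h ↦ sub_coboundary_mul w b g h
    have hf1 : f 1 = 0 := by
      have h := hfmul 1 1
      rw [mul_one, one_smul, left_eq_add] at h
      exact h
    have hfN : ∀ n ∈ I, n ∈ (MulAction.toPermHom (absoluteGaloisGroup K) A).ker → f n = 0 := by
      intro n hnI hnN
      change w.1 n - (n • b - b) = 0
      rw [hw n hnI hnN, (HerbrandLineRestriction.mem_ker_toPermHom_iff n).1 hnN b, sub_self, sub_zero]
    have hfi₀ : f i₀ = 0 := hi₀b
    have hfinv : f (i₀ : absoluteGaloisGroup K)⁻¹ = 0 := by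
      have h := hfmul (i₀ : absoluteGaloisGroup K)⁻¹ i₀
      rw [inv_mul_cancel, hf1, hfi₀, smul_zero, add_zero] at h
      exact h.symm
    have hfpow : ∀ k : ℤ, f ((i₀ : absoluteGaloisGroup K) ^ k) = 0 := by
      intro k
      induction k using Int.induction_on with
      | zero => rw [zpow_zero]; exact hf1
      | succ k ih =>
        rw [zpow_add_one, hfmul, ih, hfi₀, smul_zero, add_zero]
      | pred k ih =>
        rw [zpow_sub_one, hfmul, ih, hfinv, smul_zero, add_zero]
    refine ⟨b, fun g hg ↦ ?_⟩
    obtain ⟨k, n, hnI, hnN, rfl⟩ := hdec g hg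
    have h := hfmul ((i₀ : absoluteGaloisGroup K) ^ k) n
    rw [hfpow k, hfN n hnI hnN, smul_zero, add_zero] at h
    exact sub_eq_zero.1 h

omit [NumberField K] [TopologicalSpace A] [DiscreteTopology A] hp in
/-- **From `I ∩ N'` to `I ∩ N`.** `N' ⊴ Γ` with `[Γ : N'] · u ≡ 1 (mod p)`, `B` `p`-torsion, `w` a crossed
homomorphism vanishing on `I ∩ N'`, `g ∈ I` acting trivially: then `w g = 0` (`w` is additive along the powers
of `g`, `g^{[Γ:N']} ∈ N'`, so `[Γ : N'] • w(g) = 0 = p • w(g)`). [folklore] -/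
theorem apply_eq_zero_of_mem_ker_of_vanish_on_inf {Γ : Type} [Group Γ] [TopologicalSpace Γ]
    {B : Type} [AddCommGroup B] [DistribMulAction Γ B] [TopologicalSpace B] [DiscreteTopology B]
    (hpB : ∀ b : B, p • b = 0) (N' : Subgroup Γ) [N'.Normal] {u : ℕ} (hu : N'.index * u % p = 1)
    (I : Subgroup Γ) (w : contOneCocycles (discreteTopRep Γ B)) (hw : ∀ g ∈ I, g ∈ N' → w.1 g = 0)
    {g : Γ} (hgI : g ∈ I) (hg : ∀ b : B, g • b = b) : w.1 g = 0 := by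
  have hpow : ∀ k : ℕ, w.1 (g ^ k) = k • w.1 g := by
    intro k
    induction k with
    | zero => rw [pow_zero, contOneCocycles.apply_one, zero_nsmul]
    | succ k ih =>
      rw [pow_succ, cocycle_mul' w (g ^ k) g, ih, succ_nsmul]
      congr 1
      -- `g ^ k` acts trivially
      clear ih
      induction k with
      | zero => rw [pow_zero, one_smul]
      | succ k ih' => rw [pow_succ, mul_smul, hg, ih']
  have hk : N'.index • w.1 g = 0 := by
    rw [← hpow]
    exact hw _ (I.pow_mem hgI _) (N'.pow_index_mem g)
  rw [← mul_nsmul_eq_self_of_mod_eq_one hu (hpB (w.1 g)), mul_comm, mul_nsmul', hk, smul_zero]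

/-! ## §3 The descent: an equivariant unramified homomorphism on `N' ⊆ N` is an unramified class on `Γ_K` -/

/-- **THE LINK (inflation–restriction surjectivity at index prime to `p`, with the inertia groups).** `A` a
discrete `Γ_K`-module of PRIME order `p` with continuous orbit maps; `N' ⊴ Γ_K` an OPEN normal subgroup of
finite index PRIME TO `p` acting trivially on `A` (e.g. `N' = res Γ_L` for a Galois `L/K` splitting `A` with
`p ∤ [L:K]`, or `N' = N = ker(Γ_K → Aut A)` itself). Let `G₀ : Γ_K → A` be continuous and additive on `N'`,
`Γ_K`-EQUIVARIANT on `N'` (`G₀(g n g⁻¹) = g • G₀ n`), kill `N' ∩ I_𝔓` for every prime `𝔓` of `\bar ℤ_K`, and be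
NON-ZERO on `N'`. THEN there is a continuous crossed homomorphism `w : Γ_K → A` with `w|_{N'} = G₀|_{N'}`,
NON-ZERO class in `H¹(K, A)`, principal on EVERY inertia group `I_𝔓` — the input of the (β) Galois half
`levelPos_or_sha_of_unramified_sub_class` (p669667); converse of `hom_of_unramified_class` (p668199).
PROOF: `[G₀|_{N'}] ∈ H¹(N', A)^{Γ_K}`; `H²(Γ_K/N', A) = 0` (§1); Hochschild–Serre (element form) gives `[w]`;
coboundaries vanish on `N'`; `w = 0` on `I_𝔓 ∩ N'`, hence on `I_𝔓 ∩ N`, hence principal on `I_𝔓` (§2).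
[cite: SerreGaloisCohomology1997, I.§2.6 (b)] [cite: NeukirchSchmidtWingberg2008, (1.6.7)] -/
theorem exists_unramified_class_of_hom_of_le_ker (hcard : Nat.card A = p)
    (hcont : ∀ a : A, Continuous fun g : absoluteGaloisGroup K ↦ g • a)
    (N' : Subgroup (absoluteGaloisGroup K)) [N'.Normal] (hopen : IsOpen (N' : Set (absoluteGaloisGroup K)))
    (hN'le : N' ≤ (MulAction.toPermHom (absoluteGaloisGroup K) A).ker)
    (hidx0 : N'.index ≠ 0) (hcop : Nat.Coprime N'.index p)
    (G₀ : absoluteGaloisGroup K → A) (hGc : Continuous fun n : N' ↦ G₀ n)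
    (hadd : ∀ a ∈ N', ∀ b ∈ N', G₀ (a * b) = G₀ a + G₀ b)
    (hconj : ∀ (g : absoluteGaloisGroup K), ∀ n ∈ N', G₀ (g * n * g⁻¹) = g • G₀ n)
    (hI : ∀ (v : HeightOneSpectrum (𝓞 K)) (𝔓 : Ideal (absIntegers (𝓞 K) K)), 𝔓 ∈ v.primesAbove →
      ∀ n ∈ N', n ∈ 𝔓.inertia (absoluteGaloisGroup K) → G₀ n = 0)
    (hne : ∃ n ∈ N', G₀ n ≠ 0) :
    ∃ w : contOneCocycles (discreteTopRep (absoluteGaloisGroup K) A),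
      oneCocycleClass _ w ≠ 0 ∧ (∀ n ∈ N', w.1 n = G₀ n) ∧
      ∀ (v : HeightOneSpectrum (𝓞 K)) (𝔓 : Ideal (absIntegers (𝓞 K) K)), 𝔓 ∈ v.primesAbove →
        ∃ a : A, ∀ g ∈ 𝔓.inertia (absoluteGaloisGroup K), w.1 g = g • a - a := by
  have hker : ∀ n ∈ N', ∀ a : A, n • a = a := fun n hn ↦
    (HerbrandLineRestriction.mem_ker_toPermHom_iff n).1 (hN'le hn)
  have hpA : ∀ a : A, p • a = 0 := HerbrandLineRestriction.prime_nsmul_eq_zero_of_card_prime hcard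
  obtain ⟨u, -, hu⟩ := Nat.exists_mul_mod_eq_one_of_coprime hcop hp.out.one_lt
  haveI : CompactSpace (absoluteGaloisGroup K) := by
    change CompactSpace (AlgebraicClosure K ≃ₐ[K] AlgebraicClosure K); infer_instance
  haveI : TotallyDisconnectedSpace (absoluteGaloisGroup K) := by
    change TotallyDisconnectedSpace (AlgebraicClosure K ≃ₐ[K] AlgebraicClosure K); infer_instance
  haveI : IsClosed (N' : Set (absoluteGaloisGroup K)) := N'.isClosed_of_isOpen hopen
  set ρ := LocBridge.ofSMul A (isOpen_stabilizer_of_continuous_smul hcont) with hρ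
  let y : contOneCocycles (subgroupRep ρ.toTopRep N') :=
    ⟨⟨fun n ↦ G₀ n, hGc⟩, fun a b ↦ by
      change G₀ ((a : absoluteGaloisGroup K) * b) = G₀ a + (a : absoluteGaloisGroup K) • G₀ b
      rw [hadd a a.2 b b.2, hker a a.2]⟩
  have hinv : ∀ g : absoluteGaloisGroup K,
      conjMap ρ.toTopRep N' g 1 (oneCocycleClass _ y) = oneCocycleClass _ y := by
    intro g
    refine (conjMap_oneCocycleClass ρ.toTopRep N' g y).trans (congrArg _ (Subtype.ext ?_))
    ext n
    rw [conj_pullback_apply]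
    change g • G₀ ((subgroupConj N' g n : N') : absoluteGaloisGroup K) = G₀ n
    rw [subgroupConj_apply_coe]
    have h := hconj g⁻¹ n n.2
    rw [inv_inv] at h
    rw [h, smul_inv_smul]
  haveI : Subsingleton (continuousCohomology 2 (ContinuousRep.quotientInvariants N' ρ).toTopRep) :=
    subsingleton_continuousCohomology_two_quotientInvariants_of_coprime (K := K) (A := A) hcont hpA N'
      hopen hidx0 hu
  obtain ⟨xc, hxc⟩ :=
    MultTransportTwistedDescent.exists_resSubgroup_eq_of_forall_conjMap_eq_of_subsingleton_two N' ρ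
      (oneCocycleClass _ y) hinv
  obtain ⟨w, rfl⟩ := oneCocycleClass_surjective _ xc
  have hwN : ∀ n ∈ N', w.1 n = G₀ n := by
    rw [resSubgroup_oneCocycleClass] at hxc
    have h0 := sub_eq_zero.2 hxc
    change oneCocycleClass (subgroupRep ρ.toTopRep N') _ - oneCocycleClass (subgroupRep ρ.toTopRep N') y = 0
      at h0
    rw [← oneCocycleClass_sub, oneCocycleClass_eq_zero_iff] at h0
    obtain ⟨a, ha⟩ := h0
    intro n hn
    have h1 := ha ⟨n, hn⟩
    rw [Submodule.coe_sub, ContinuousMap.sub_apply, resSubgroup_pullback_apply] at h1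
    change w.1 n - G₀ n = n • a - a at h1
    rwa [hker n hn, sub_self, sub_eq_zero] at h1
  refine ⟨w, fun h0 ↦ ?_, hwN, fun v 𝔓 h𝔓 ↦ ?_⟩
  · -- `[w] ≠ 0`: a coboundary vanishes on `N'`, `G₀` does not
    obtain ⟨a, ha⟩ := (oneCocycleClass_eq_zero_iff _ w).1 h0
    obtain ⟨n, hn, hne'⟩ := hne
    apply hne'
    rw [← hwN n hn, ha n]
    change n • a - a = 0
    rw [hker n hn, sub_self]
  · -- principal on `I_𝔓`: vanishing on `I_𝔓 ∩ N'` ⟹ on `I_𝔓 ∩ N` ⟹ principal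
    refine exists_principal_on_of_vanish_on_inf_ker hcard (𝔓.inertia (absoluteGaloisGroup K)) w
      fun g hgI hgN ↦ ?_
    exact apply_eq_zero_of_mem_ker_of_vanish_on_inf hpA N' hu (𝔓.inertia (absoluteGaloisGroup K)) w
      (fun g' hg'I hg'N ↦ by rw [hwN g' hg'N]; exact hI v 𝔓 h𝔓 g' hg'N hg'I) hgI
      ((HerbrandLineRestriction.mem_ker_toPermHom_iff g).1 hgN)

/-- **THE LINK for `N = ker(Γ_K → Aut A)` itself** (index `∣ p − 1`): the converse of `hom_of_unramified_class`
(p668199). [cite: SerreGaloisCohomology1997, I.§2.6 (b)] -/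
theorem exists_unramified_class_of_hom (hcard : Nat.card A = p)
    (hcont : ∀ a : A, Continuous fun g : absoluteGaloisGroup K ↦ g • a)
    (G₀ : absoluteGaloisGroup K → A)
    (hGc : Continuous fun n : (MulAction.toPermHom (absoluteGaloisGroup K) A).ker ↦ G₀ n)
    (hadd : ∀ a ∈ (MulAction.toPermHom (absoluteGaloisGroup K) A).ker,
      ∀ b ∈ (MulAction.toPermHom (absoluteGaloisGroup K) A).ker, G₀ (a * b) = G₀ a + G₀ b)
    (hconj : ∀ (g : absoluteGaloisGroup K), ∀ n ∈ (MulAction.toPermHom (absoluteGaloisGroup K) A).ker,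
      G₀ (g * n * g⁻¹) = g • G₀ n)
    (hI : ∀ (v : HeightOneSpectrum (𝓞 K)) (𝔓 : Ideal (absIntegers (𝓞 K) K)), 𝔓 ∈ v.primesAbove →
      ∀ n ∈ (MulAction.toPermHom (absoluteGaloisGroup K) A).ker,
        n ∈ 𝔓.inertia (absoluteGaloisGroup K) → G₀ n = 0)
    (hne : ∃ n ∈ (MulAction.toPermHom (absoluteGaloisGroup K) A).ker, G₀ n ≠ 0) :
    ∃ w : contOneCocycles (discreteTopRep (absoluteGaloisGroup K) A),
      oneCocycleClass _ w ≠ 0 ∧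
      (∀ n ∈ (MulAction.toPermHom (absoluteGaloisGroup K) A).ker, w.1 n = G₀ n) ∧
      ∀ (v : HeightOneSpectrum (𝓞 K)) (𝔓 : Ideal (absIntegers (𝓞 K) K)), 𝔓 ∈ v.primesAbove →
        ∃ a : A, ∀ g ∈ 𝔓.inertia (absoluteGaloisGroup K), w.1 g = g • a - a := by
  haveI : Finite A := Nat.finite_of_card_ne_zero (by rw [hcard]; exact hp.out.ne_zero)
  have hdvd := HerbrandLineRestriction.index_ker_toPermHom_dvd (G := absoluteGaloisGroup K) (A := A) hcard
  obtain ⟨-, -, hidx0⟩ := exists_index_mul_mod_eq_one (K := K) (A := A) hcard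
  have hp1 : 0 < p - 1 := by have := hp.out.two_le; omega
  have hlt : (MulAction.toPermHom (absoluteGaloisGroup K) A).ker.index < p :=
    lt_of_le_of_lt (Nat.le_of_dvd hp1 hdvd) (Nat.sub_lt hp.out.pos Nat.one_pos)
  have hcop : Nat.Coprime (MulAction.toPermHom (absoluteGaloisGroup K) A).ker.index p :=
    Nat.coprime_comm.mp ((Nat.Prime.coprime_iff_not_dvd hp.out).2
      fun h ↦ absurd (Nat.le_of_dvd (Nat.pos_of_ne_zero hidx0) h) (not_le.mpr hlt))
  exact exists_unramified_class_of_hom_of_le_ker hcard hcont _ (HerbrandLineRestriction.isOpen_ker_toPermHom hcont)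
    le_rfl hidx0 hcop G₀ hGc hadd hconj hI hne

end Summit.BirchSwinnertonDyer.BirchSwinnertonDyer.Theorems.PrintCFram.LevelDictionary

end
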